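import Summits.QuantumFields.GaugeBoot.OneOverNSeriesSum
import Summits.QuantumFields.GaugeBoot.OneOverNMaster
import HarnessLib

/-!
# Power series in `β` of the `1/N` coefficients, IV: Chatterjee–Jafarov's Theorem 7.1 (gauge-boot, ADDENDUM 31 part D)

HONEST FRAMING (cell `pub-gaugeboot`, page 1 of every file): the venture produces certified bounds
on lattice expectations at stated coupling, gauge group, dimension and torus size; NOT a mass gap,
NOT a continuum limit, NOT a string tension; NOT Yang–Mills-summit-bearing (barriers
`FixedCouplingUltralocality`, `PerturbativeInvisibility`).  Strong-coupling `SO(N)` lattice gauge theory with free boundary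
condition (S. Chatterjee, Comm. Math. Phys. **366** (2019); S. Chatterjee, J. Jafarov, arXiv:1604.04777); nothing about
four-dimensional continuum Yang–Mills or a mass gap.

## Content

★★★ `oneOverN_powerSeries` — **Theorem 7.1 of Chatterjee–Jafarov in the tree's (symmetrized) vocabulary**: for `d ≥ 2`
there are `ρ(d,0) ≥ ρ(d,1) ≥ ⋯ > 0` such that, with `f_k = F_{k+2}` THE coefficients of the `1/N` expansion
`⟨W_{l₁}⋯W_{lₙ}⟩_{Λ_N,N,β}/Nⁿ = f_0 + f_1/N + ⋯ + f_k/N^k + o(N^{−k})` (along `[−N,N]^d`, `|β| ≤ ρ(d,k)`; `f_0 = Σ_X w_β(X)`)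
and with `b` the symmetrized coefficient family of `seriesCoeff_exists` (levels, values at `∅`, the double recursion —
all restated), for every `k`, every `|β| ≤ ρ(d,k)` and every genuine loop sequence `s`

`f_k(β, s) = Σ_{i ≥ 0} b_{k+2,i}(s) βⁱ`, the series converging absolutely.

Proof (the source's, §7): the sums `g_j(β,·) = Σ_i b_{j,i} βⁱ` have the right values at `∅`, obey the exponential bound
`2B_j(4K_j)^{|s|}` (`series_summable_of_bound`, the Catalan bound of part B) and the recursion (5.2) (`series_recursion_of_hasSum`),
so the uniqueness of the coefficient hierarchy (`oneOverN_master` (C), the source's Theorem 5.6) identifies them with `f`.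

Everything is `[folklore]` given parts A–C and `oneOverN_master`.
-/

noncomputable section

open Finset Filter Topology
open Literature.Probability.LatticeModels (Site box)
open Literature.MathematicalPhysics.QuantumFieldTheory.Chatterjee2019LargeN
open Literature.MathematicalPhysics.QuantumFieldTheory.Chatterjee2019LargeN.CoeffCatalanBoundProof

namespace Summit.QuantumFields.GaugeBoot

namespace StringDuality

variable (d : ℕ)

/-- ★★★ **The power series expansion of the `1/N` coefficients (Chatterjee–Jafarov, Theorem 7.1; symmetrized form).**
For `d ≥ 2` there are `ρ(d,0) ≥ ρ(d,1) ≥ ⋯ > 0`, the family `F` of the lane's `1/N` expansion (clause (i): for `|β| ≤ ρ(d,k)`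
and genuine `s`, `N^k(⟨W_{l₁}⋯W_{lₙ}⟩_{[−N,N]^d,N,β}/Nⁿ − Σ_{i<k} F_{i+2}(β,s)N^{−i}) → F_{k+2}(β,s)`, and `F_2(β,·) = Σ_X w_β(X)`)
and the symmetrized Chatterjee–Jafarov coefficient family `b : ℕ → ℕ → 𝒮 → ℝ` (clause (ii): levels `0,1` vanish,
`b_{2,0}(∅) = 1`, all other values at `∅` and all values at non-null sequences with a null component vanish, and the recursion
`|s| b_{k+2,i}(s) − (Σ_{𝕊⁻} b_{k+2,i} − Σ_{𝕊⁺} b_{k+2,i} + Σ_{𝔻⁻} b_{k+2,i−1} − Σ_{𝔻⁺} b_{k+2,i−1})`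
`= |s| b_{k+1,i}(s) + (Σ_{𝕋⁻} b_{k+1,i} − Σ_{𝕋⁺} b_{k+1,i}) + (Σ_{𝕄⁻} b_{k,i} − Σ_{𝕄⁺} b_{k,i})`), such that (clause (iii))
for every `k`, `|β| ≤ ρ(d,k)` and genuine `s`: `Σ_i |b_{k+2,i}(s)| |β|ⁱ < ∞` and
**`F_{k+2}(β, s) = Σ_{i=0}^∞ b_{k+2,i}(s) βⁱ`**; consequently (clause (iv)) `β ↦ F_{k+2}(β, s)` is real analytic on
`(−ρ(d,k), ρ(d,k))`.
[cite: ChatterjeeJafarov2016OneOverN, Theorem 7.1, Lemma 7.3, Theorem 5.6, Theorem 3.1 (ii); Chatterjee2019LargeN, Theorem 3.1, Corollary 3.5] -/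
theorem oneOverN_powerSeries (hd : 2 ≤ d) :
    ∃ ρ : ℕ → ℝ, (∀ k, 0 < ρ k) ∧ (∀ k, ρ (k + 1) ≤ ρ k) ∧
    ∃ F : ℕ → ℝ → LoopSeq d → ℝ, ∃ b : ℕ → ℕ → LoopSeq d → ℝ,
      -- (i) `F` is the `1/N` expansion
      (∀ (k : ℕ) (β : ℝ), |β| ≤ ρ k → ∀ s : LoopSeq d, IsLoopSeq s →
        Tendsto (fun N : ℕ => (N : ℝ) ^ k *
          (phi N β (box d N) s - ∑ i ∈ Finset.range k, F (i + 2) β s / (N : ℝ) ^ i)) atTop (𝓝 (F (k + 2) β s))) ∧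
      (∀ β : ℝ, |β| ≤ ρ 0 → ∀ s : LoopSeq d, IsLoopSeq s → F 2 β s = ∑' X : Trajectory s, X.weight β) ∧
      -- (ii) `b` is the symmetrized Chatterjee–Jafarov coefficient family
      (∀ (i : ℕ) (u : LoopSeq d), b 0 i u = 0) ∧ (∀ (i : ℕ) (u : LoopSeq d), b 1 i u = 0) ∧
      (∀ k i, b (k + 2) i [] = if k = 0 ∧ i = 0 then 1 else 0) ∧
      (∀ (j i : ℕ) (s : LoopSeq d), s ≠ [] → ¬ (∀ l ∈ s, l ≠ []) → b j i s = 0) ∧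
      (∀ (k : ℕ) (s : LoopSeq d), s ≠ [] → (∀ l ∈ s, l ≠ []) →
        (s.len : ℝ) * b (k + 2) 0 s -
            ((∑ o : InvIdx s, b (k + 2) 0 (s.negSplitAt o)) - (∑ o : SameIdx s, b (k + 2) 0 (s.posSplitAt o))) =
          (s.len : ℝ) * b (k + 1) 0 s
            + ((∑ o : SameIdx s, b (k + 1) 0 (s.negTwistAt o)) - ∑ o : InvIdx s, b (k + 1) 0 (s.posTwistAt o))
            + ((∑ o : MergeIdx s, b k 0 (s.negMergeAt o)) - ∑ o : MergeIdx s, b k 0 (s.posMergeAt o))) ∧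
      (∀ (k i : ℕ) (s : LoopSeq d), s ≠ [] → (∀ l ∈ s, l ≠ []) →
        (s.len : ℝ) * b (k + 2) (i + 1) s -
            ((∑ o : InvIdx s, b (k + 2) (i + 1) (s.negSplitAt o)) - (∑ o : SameIdx s, b (k + 2) (i + 1) (s.posSplitAt o))
              + (∑ o : DeformIdx s, b (k + 2) i (s.negDeformAt o)) - (∑ o : DeformIdx s, b (k + 2) i (s.posDeformAt o))) =
          (s.len : ℝ) * b (k + 1) (i + 1) s
            + ((∑ o : SameIdx s, b (k + 1) (i + 1) (s.negTwistAt o)) - ∑ o : InvIdx s, b (k + 1) (i + 1) (s.posTwistAt o))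
            + ((∑ o : MergeIdx s, b k (i + 1) (s.negMergeAt o)) - ∑ o : MergeIdx s, b k (i + 1) (s.posMergeAt o))) ∧
      -- (iii) ★ the power series expansion
      (∀ (k : ℕ) (β : ℝ), |β| ≤ ρ k → ∀ s : LoopSeq d, IsLoopSeq s →
        Summable (fun i => |b (k + 2) i s| * |β| ^ i) ∧ HasSum (fun i => b (k + 2) i s * β ^ i) (F (k + 2) β s)) ∧
      -- (iv) real analyticity of `β ↦ f_k(β, s)` on `(−ρ(d,k), ρ(d,k))`
      (∀ (k : ℕ) (s : LoopSeq d), IsLoopSeq s → ∀ β : ℝ, |β| < ρ k → AnalyticAt ℝ (fun β' => F (k + 2) β' s) β) := by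
  classical
  -- ### the expansion
  obtain ⟨β₀, hpos, hanti, C, L, hC, hL, F, hF0, hF1, HA, HB, HC⟩ := oneOverN_master d hd
  -- ### the coefficient family and its Catalan bound
  obtain ⟨b, h0, h1, hnil, hbad, hrec0, hrecS⟩ := seriesCoeff_exists (d := d)
  obtain ⟨K, R, B, hK1, hKmono, hRpos, hRmono, hB1, hBmono, hbd⟩ := seriesCoeff_bound h0 h1 hnil hrec0 hrecS
  have hKm : Monotone K := monotone_nat_of_le_succ hKmono
  have hRm : Monotone R := monotone_nat_of_le_succ hRmono
  have hBm : Monotone B := monotone_nat_of_le_succ hBmono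
  -- ### uniqueness thresholds and radii
  have hUex := fun k => HC k (2 * B (k + 2)) (4 * K (k + 2)) (by linarith [hB1 (k + 2)]) (by linarith [hK1 (k + 2)])
  choose β₁ hβ₁ hU using hUex
  set r : ℕ → ℝ := fun k => 1 / (2 * R (k + 2)) with hr
  have hr_pos : ∀ k, 0 < r k := fun k => by rw [hr]; exact div_pos one_pos (by linarith [hRpos (k + 2)])
  obtain ⟨ρ, hρ0, hρs⟩ : ∃ ρ : ℕ → ℝ, ρ 0 = min (β₀ 0) (min (β₁ 0) (r 0)) ∧
      ∀ k, ρ (k + 1) = min (ρ k) (min (β₀ (k + 1)) (min (β₁ (k + 1)) (r (k + 1)))) :=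
    ⟨fun k => Nat.rec (min (β₀ 0) (min (β₁ 0) (r 0))) (fun k x => min x (min (β₀ (k + 1)) (min (β₁ (k + 1)) (r (k + 1))))) k,
      rfl, fun _ => rfl⟩
  have hρ_pos : ∀ k, 0 < ρ k := by
    intro k
    induction k with
    | zero => rw [hρ0]; exact lt_min (hpos 0) (lt_min (hβ₁ 0) (hr_pos 0))
    | succ k ih => rw [hρs]; exact lt_min ih (lt_min (hpos _) (lt_min (hβ₁ _) (hr_pos _)))
  have hρ_anti : ∀ k, ρ (k + 1) ≤ ρ k := fun k => by rw [hρs]; exact min_le_left _ _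
  have hρ_le : ∀ k, ρ k ≤ β₀ k ∧ ρ k ≤ β₁ k ∧ ρ k ≤ r k := by
    intro k
    rcases k with _ | k
    · rw [hρ0]
      exact ⟨min_le_left _ _, (min_le_right _ _).trans (min_le_left _ _), (min_le_right _ _).trans (min_le_right _ _)⟩
    · rw [hρs]
      exact ⟨(min_le_right _ _).trans (min_le_left _ _),
        (min_le_right _ _).trans ((min_le_right _ _).trans (min_le_left _ _)),
        (min_le_right _ _).trans ((min_le_right _ _).trans (min_le_right _ _))⟩
  -- ### the sums `g_j(β, t) = Σ_i b_{j,i}(t) βⁱ` at the levels `j ≤ k + 2`, for `|β| ≤ r k`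
  have hlevel : ∀ (k : ℕ) (β : ℝ), |β| ≤ r k → ∀ j, j ≤ k + 2 → ∀ t : LoopSeq d, IsLoopSeq t →
      Summable (fun i => |b j i t| * |β| ^ i) ∧ HasSum (fun i => b j i t * β ^ i) (∑' i, b j i t * β ^ i) ∧
      |∑' i, b j i t * β ^ i| ≤ 2 * B (k + 2) * (4 * K (k + 2)) ^ t.len := by
    intro k β hβ j hj t ht
    have hK0 : 0 ≤ K j := zero_le_one.trans (hK1 j)
    have hΦ0 : 0 ≤ K j ^ t.index * catProd t := mul_nonneg (pow_nonneg hK0 _) (catProd_nonneg t)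
    have hβj : |β| ≤ 1 / (2 * R j) := by
      refine hβ.trans ?_
      rw [hr]
      exact one_div_le_one_div_of_le (by linarith [hRpos j]) (by linarith [hRm hj])
    obtain ⟨habs, hsum, -, hle⟩ := series_summable_of_bound (a := fun i => b j i t) (C := B j * (K j ^ t.index * catProd t))
      (r := R j) (mul_nonneg (zero_le_one.trans (hB1 j)) hΦ0) (hRpos j)
      (fun i => by rw [mul_right_comm]; exact hbd j i t ht) hβj
    refine ⟨habs, hsum.hasSum, hle.trans ?_⟩
    calc 2 * (B j * (K j ^ t.index * catProd t)) ≤ 2 * (B (k + 2) * (4 * K (k + 2)) ^ t.len) := by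
          refine mul_le_mul_of_nonneg_left (mul_le_mul (hBm hj) ((weight_le_pow (hK1 j) t).trans ?_) hΦ0
            (zero_le_one.trans (hB1 _))) (by norm_num)
          exact pow_le_pow_left₀ (by linarith [hK1 j]) (by linarith [hKm hj]) _
      _ = 2 * B (k + 2) * (4 * K (k + 2)) ^ t.len := by ring
  -- ### (iii): identify the sums with `F` by the uniqueness of the hierarchy
  have hmain : ∀ (k : ℕ) (β : ℝ), |β| ≤ ρ k → ∀ s : LoopSeq d, IsLoopSeq s →
      Summable (fun i => |b (k + 2) i s| * |β| ^ i) ∧ HasSum (fun i => b (k + 2) i s * β ^ i) (F (k + 2) β s) := by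
    intro k β hβ s hs
    have hβr : |β| ≤ r k := hβ.trans (hρ_le k).2.2
    have hβ1 : |β| ≤ β₁ k := hβ.trans (hρ_le k).2.1
    set G : ℕ → LoopSeq d → ℝ := fun j t => ∑' i, b j i t * β ^ i with hG
    have hGsum : ∀ j, j ≤ k + 2 → ∀ t : LoopSeq d, IsLoopSeq t → HasSum (fun i => b j i t * β ^ i) (G j t) :=
      fun j hj t ht => (hlevel k β hβr j hj t ht).2.1
    have hident : ∀ i, i ≤ k → ∀ t : LoopSeq d, IsLoopSeq t → G (i + 2) t = F (i + 2) β t := by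
      refine hU k β hβ1 G (fun u => ?_) (fun u => ?_) (fun i hi => ?_) (fun i hi t ht => ?_) (fun i hi t ht hne => ?_)
      · simp only [hG, h0, zero_mul, tsum_zero]
      · simp only [hG, h1, zero_mul, tsum_zero]
      · exact (series_nil hnil i β).tsum_eq
      · exact ((hlevel k β hβr (i + 2) (by omega) t ht).2.2).trans
          (mul_le_mul_of_nonneg_right le_rfl (pow_nonneg (by linarith [hK1 (k + 2)]) _))
      · exact series_recursion_of_hasSum i (fun j hj u hu => hGsum j (by omega) u hu) hrec0 hrecS t ht hne
    refine ⟨(hlevel k β hβr (k + 2) le_rfl s hs).1, ?_⟩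
    rw [← hident k le_rfl s hs]
    exact hGsum (k + 2) le_rfl s hs
  refine ⟨ρ, hρ_pos, hρ_anti, F, b, fun k β hβ s hs => ?_, fun β hβ s hs => HB β (hβ.trans (hρ_le 0).1) s hs,
    h0, h1, hnil, hbad, hrec0, hrecS, hmain, fun k s hs β hβ => ?_⟩
  · exact (HA k β (hβ.trans (hρ_le k).1)).2.2.2.2.1 s hs
  -- ### (iv): analyticity inside the disc of convergence
  have hK0 : 0 ≤ K (k + 2) := zero_le_one.trans (hK1 _)
  have hΦ0 : 0 ≤ K (k + 2) ^ s.index * catProd s := mul_nonneg (pow_nonneg hK0 _) (catProd_nonneg s)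
  have hRne : R (k + 2) ≠ 0 := (hRpos _).ne'
  have hRρ : R (k + 2) * ρ k ≤ 1 / 2 := by
    have h1 : R (k + 2) * r k = 1 / 2 := by simp only [hr]; field_simp
    calc R (k + 2) * ρ k ≤ R (k + 2) * r k := mul_le_mul_of_nonneg_left (hρ_le k).2.2 (hRpos _).le
      _ = 1 / 2 := h1
  let p : FormalMultilinearSeries ℝ ℝ ℝ := FormalMultilinearSeries.ofScalars ℝ (fun i => b (k + 2) i s)
  set ρ' : NNReal := (ρ k).toNNReal with hρ'def
  have hρ' : (ρ' : ℝ) = ρ k := Real.coe_toNNReal _ (hρ_pos k).le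
  have hcoef : ∀ n : ℕ, ‖p n‖ * (ρ' : ℝ) ^ n ≤ B (k + 2) * (K (k + 2) ^ s.index * catProd s) := by
    intro n
    rw [FormalMultilinearSeries.ofScalars_norm, Real.norm_eq_abs, hρ']
    calc |b (k + 2) n s| * ρ k ^ n ≤ B (k + 2) * R (k + 2) ^ n * (K (k + 2) ^ s.index * catProd s) * ρ k ^ n :=
          mul_le_mul_of_nonneg_right (hbd (k + 2) n s hs) (pow_nonneg (hρ_pos k).le _)
      _ = B (k + 2) * (K (k + 2) ^ s.index * catProd s) * (R (k + 2) * ρ k) ^ n := by rw [mul_pow]; ring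
      _ ≤ B (k + 2) * (K (k + 2) ^ s.index * catProd s) * 1 := by
          refine mul_le_mul_of_nonneg_left ?_ (mul_nonneg (zero_le_one.trans (hB1 _)) hΦ0)
          calc (R (k + 2) * ρ k) ^ n ≤ (1 / 2 : ℝ) ^ n :=
                pow_le_pow_left₀ (mul_nonneg (hRpos _).le (hρ_pos k).le) hRρ n
            _ ≤ 1 := pow_le_one₀ (by norm_num) (by norm_num)
      _ = B (k + 2) * (K (k + 2) ^ s.index * catProd s) := mul_one _
  have hrad : (ρ' : ENNReal) ≤ p.radius := p.le_radius_of_bound _ hcoef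
  have hρ'pos : (0 : ENNReal) < ρ' := by
    rw [ENNReal.coe_pos, hρ'def]
    exact Real.toNNReal_pos.mpr (hρ_pos k)
  have hps := p.hasFPowerSeriesOnBall (lt_of_lt_of_le hρ'pos hrad)
  have hmem : β ∈ Metric.eball (0 : ℝ) p.radius := by
    rw [Metric.mem_eball]
    refine lt_of_lt_of_le ?_ hrad
    show edist β 0 < ENNReal.ofReal (ρ k)
    rw [edist_dist, Real.dist_0_eq_abs]
    exact (ENNReal.ofReal_lt_ofReal_iff (hρ_pos k)).mpr hβ
  have han : AnalyticAt ℝ p.sum β := hps.analyticAt_of_mem hmem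
  refine han.congr ?_
  have hopen : IsOpen {x : ℝ | |x| < ρ k} := isOpen_lt continuous_abs continuous_const
  filter_upwards [hopen.mem_nhds hβ] with x hx
  have hx' : |x| ≤ ρ k := le_of_lt hx
  rw [show p.sum x = FormalMultilinearSeries.ofScalarsSum (E := ℝ) (fun i => b (k + 2) i s) x from rfl,
    FormalMultilinearSeries.ofScalars_sum_eq]
  simp only [smul_eq_mul]
  exact ((hmain k x hx' s hs).2).tsum_eq

end StringDuality

end Summit.QuantumFields.GaugeBoot

end
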